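import Mathlib
import Summits.AtomisticToContinuum.HydrodynamicLimit.Theorems.ImplosionDichotomyDenseExcursionSonicCavityDefsB

/-!
# `CentreContent` from a bulk amplitude ratio at the matching point (the slaving coefficient is `O(1/|Im Λ|)`)
# (crux `DenseExcursion`, line `sonic-cavity-renewal`, brick for `centreContent_of_tube`)

Helper file (`--supports stmt-AtomisticToContinuum-12586`, line lead a2, stub-worker W3 for `centreContent_of_tube`).

`CentreContent r W S` (`…SonicCavityDefsB`) asks `‖m(x_m)‖ ≤ 250‖D‖` with `D = p − ρ m` the p-wave content at
`x_m = matchPoint = −7/10` (`p = ŵ + 3ŝ`, `m = ŵ − 3ŝ`, `ρ = slavingCoeff`). This file isolates the elementary last step: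
the slaving coefficient is small, `‖slavingCoeff(x_m)‖ ≤ 3/1000` for `|Im Λ| > boxTop = 1000` (numerator
`|W′/3 + S′ + 2S| ≤ 1/6 + e^{7/10}·(5/4) ≤ 3` by CavityTube (c); denominator `Q = (Λ − b₊₊) − (c₊/c₋)(Λ − b₋₋)` with
`c₊ > 0 > c₋` in the core, so `|Q| ≥ |Im Q| = |Im Λ|(1 + c₊/|c₋|) ≥ |Im Λ|`), hence ANY bound
`‖m(x_m)‖ ≤ 140‖p(x_m)‖` for the modes of the half-strip gives `CentreContent` (`140/(1 − 140·0.003) ≤ 250`):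
`centreContent_of_bulk_ratio` (registered helper). The remaining analytic input of `centreContent_of_tube` is therefore
exactly the amplitude ratio `‖m(x_m)‖ ≤ 140‖p(x_m)‖` (inner standing wave `centre_inner_standing_wave`, landed, gives
`‖m‖ ≤ 2‖p‖` at `log(1/100)`; the weighted Levinson transport `…SonicCentreContentLevinson` carries it to `x_m`).
-/

noncomputable section

open Set

namespace Summit.AtomisticToContinuum.HydrodynamicLimit.Theorems.SonicCavityRenewal

open Summit.AtomisticToContinuum.HydrodynamicLimit.Theorems.R2OneModeTwoConditions

/-- `exp (7/10) ≤ 219/100` (from `exp x ≤ 1 + x + x²` on `[0, 1]`). [folklore] -/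
theorem exp_seven_tenths_le : Real.exp (7 / 10) ≤ 219 / 100 := by
  have h := Real.abs_exp_sub_one_sub_id_le (x := 7 / 10) (by rw [abs_of_pos (by norm_num)]; norm_num)
  have h2 := (abs_le.mp h).2
  norm_num at h2 ⊢
  linarith

/-- THE SLAVING COEFFICIENT IS `O(1/|Im Λ|)`: for a monatomic profile in the cavity tube and `|Im Λ| > 1000`,
`‖slavingCoeff r W S Λ matchPoint‖ ≤ 3/1000`. [folklore] -/
theorem norm_slavingCoeff_le {r : ℝ} {W S : ℝ → ℝ} {Λ : ℂ} (hP : IsMonatomicProfile r W S) (hT : CavityTube r W S)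
    (him : boxTop < |Λ.im|) : ‖slavingCoeff r W S Λ matchPoint‖ ≤ 3 / 1000 := by
  obtain ⟨-, -, -, hS, hSpos, -⟩ := hP
  obtain ⟨-, hsup, -, -, -, -, -, hcW, hcS, -, -⟩ := hT
  have hS1 : Differentiable ℝ S := hS.differentiable (by simp)
  have hxm : matchPoint = -(7 / 10) := rfl
  have hx1 : matchPoint ≤ 1 := by rw [hxm]; norm_num
  obtain ⟨hW, hW', -⟩ := hcW matchPoint hx1
  obtain ⟨-, hs₂, hs', -⟩ := hcS matchPoint hx1
  have hds : deriv (fun y => Real.exp y * S y) matchPoint =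
      Real.exp matchPoint * S matchPoint + Real.exp matchPoint * deriv S matchPoint :=
    ((Real.hasDerivAt_exp _).mul (hS1 _).hasDerivAt).deriv
  rw [hds] at hs'
  have htop : (1000 : ℝ) < |Λ.im| := by simpa [boxTop] using him
  -- signs of the characteristic speeds at the matching point
  have hcp : 0 < W matchPoint - 1 + S matchPoint := by
    have := hsup matchPoint (by rw [hxm]; norm_num); linarith
  have hcm : W matchPoint - 1 - S matchPoint < 0 := by
    have := hSpos matchPoint; have := (abs_le.mp hW).2; linarith
  -- the numerator
  have hexp : Real.exp (-matchPoint) ≤ 219 / 100 := by rw [hxm, neg_neg]; exact exp_seven_tenths_le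
  have hnum : |deriv W matchPoint / 3 + deriv S matchPoint + 2 * S matchPoint| ≤ 3 := by
    have e1 : deriv S matchPoint + 2 * S matchPoint =
        Real.exp (-matchPoint) * (Real.exp matchPoint * S matchPoint +
          (Real.exp matchPoint * S matchPoint + Real.exp matchPoint * deriv S matchPoint)) := by
      have hee : Real.exp (-matchPoint) * Real.exp matchPoint = 1 := by
        rw [← Real.exp_add, neg_add_cancel, Real.exp_zero]
      linear_combination (-(2 * S matchPoint + deriv S matchPoint)) * hee
    have h1 : |Real.exp matchPoint * S matchPoint + (Real.exp matchPoint * S matchPoint +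
        Real.exp matchPoint * deriv S matchPoint)| ≤ 5 / 4 := by
      refine (abs_add_le _ _).trans ?_
      rw [abs_of_nonneg (mul_pos (Real.exp_pos _) (hSpos _)).le]
      linarith
    have h2 : |deriv S matchPoint + 2 * S matchPoint| ≤ 219 / 100 * (5 / 4) := by
      rw [e1, abs_mul, abs_of_pos (Real.exp_pos _)]
      exact mul_le_mul hexp h1 (abs_nonneg _) (by norm_num)
    have h3 : |deriv W matchPoint / 3| ≤ 1 / 6 := by
      rw [abs_div, abs_of_pos (by norm_num : (0:ℝ) < 3)]; linarith [hW']
    have := abs_add_le (deriv W matchPoint / 3) (deriv S matchPoint + 2 * S matchPoint)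
    rw [add_assoc]
    linarith
  -- the denominator
  set Q : ℂ := (Λ - ((2 / 3 * deriv W matchPoint + 2 * W matchPoint - r + 2 * deriv S matchPoint +
      4 * S matchPoint : ℝ) : ℂ)) - (((W matchPoint - 1 + S matchPoint) / (W matchPoint - 1 - S matchPoint) : ℝ) : ℂ) *
        (Λ - ((2 / 3 * deriv W matchPoint + 2 * W matchPoint - r - 2 * deriv S matchPoint - 4 * S matchPoint : ℝ) : ℂ))
    with hQ
  have hratio : (W matchPoint - 1 + S matchPoint) / (W matchPoint - 1 - S matchPoint) ≤ 0 :=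
    div_nonpos_of_nonneg_of_nonpos hcp.le hcm.le
  have hQim : Q.im = Λ.im * (1 - (W matchPoint - 1 + S matchPoint) / (W matchPoint - 1 - S matchPoint)) := by
    simp only [hQ, Complex.sub_im, Complex.mul_im, Complex.ofReal_re, Complex.ofReal_im, Complex.sub_re]
    ring
  have hQn : 1000 ≤ ‖Q‖ := by
    have h1 : |Q.im| ≤ ‖Q‖ := Complex.abs_im_le_norm Q
    rw [hQim, abs_mul] at h1
    have h2 : 1 ≤ |1 - (W matchPoint - 1 + S matchPoint) / (W matchPoint - 1 - S matchPoint)| := by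
      rw [abs_of_nonneg (by linarith)]; linarith
    nlinarith [abs_nonneg Λ.im]
  -- conclusion
  have hdef : slavingCoeff r W S Λ matchPoint =
      ((deriv W matchPoint / 3 + deriv S matchPoint + 2 * S matchPoint : ℝ) : ℂ) / Q := rfl
  rw [hdef, norm_div, Complex.norm_real, Real.norm_eq_abs]
  rw [div_le_iff₀ (by linarith)]
  nlinarith [abs_nonneg (deriv W matchPoint / 3 + deriv S matchPoint + 2 * S matchPoint)]

/-- **Registered helper `centreContent_of_bulk_ratio`: `CentreContent` FROM A BULK AMPLITUDE RATIO.** For a monatomic profile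
in the cavity tube, if every smooth radial mode of the half-strip `−1/4 < Re Λ ≤ boxSide`, `|Im Λ| > boxTop` has
`‖m(x_m)‖ ≤ 140‖p(x_m)‖` at the matching point (`m = ŵ − 3ŝ`, `p = ŵ + 3ŝ`), then `CentreContent r W S`:
`‖D‖ ≥ ‖p‖ − ‖slavingCoeff‖‖m‖ ≥ ‖m‖/140 − 0.003‖m‖ ≥ ‖m‖/250`. [folklore] -/
theorem centreContent_of_bulk_ratio : ∀ (r : ℝ) (W S : ℝ → ℝ), IsMonatomicProfile r W S → CavityTube r W S → (∀ (Λ : ℂ) (ŵ ŝ : ℝ → ℂ), IsSmoothRadialMode r W S Λ ŵ ŝ → -(1 / 4 : ℝ) < Λ.re → Λ.re ≤ boxSide → boxTop < |Λ.im| → ‖ŵ matchPoint - 3 * ŝ matchPoint‖ ≤ 140 * ‖ŵ matchPoint + 3 * ŝ matchPoint‖) → CentreContent r W S := by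
  intro r W S hP hT hratio Λ ŵ ŝ hm hre₁ hre₂ him
  have hK := hratio Λ ŵ ŝ hm hre₁ hre₂ him
  have hρ := norm_slavingCoeff_le (Λ := Λ) hP hT him
  set m := ŵ matchPoint - 3 * ŝ matchPoint with hmdef
  set p := ŵ matchPoint + 3 * ŝ matchPoint with hpdef
  have hD : pWaveContent r W S Λ ŵ ŝ = p - slavingCoeff r W S Λ matchPoint * m := rfl
  have h1 : ‖p‖ ≤ ‖pWaveContent r W S Λ ŵ ŝ‖ + ‖slavingCoeff r W S Λ matchPoint‖ * ‖m‖ := by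
    rw [hD, ← norm_mul]
    have := norm_le_norm_add_norm_sub' p (p - slavingCoeff r W S Λ matchPoint * m)
    simp only [sub_sub_cancel] at this
    linarith
  have h2 : ‖slavingCoeff r W S Λ matchPoint‖ * ‖m‖ ≤ 3 / 1000 * ‖m‖ :=
    mul_le_mul_of_nonneg_right hρ (norm_nonneg _)
  nlinarith [norm_nonneg m, norm_nonneg (pWaveContent r W S Λ ŵ ŝ)]

end Summit.AtomisticToContinuum.HydrodynamicLimit.Theorems.SonicCavityRenewal

end
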